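import Literature.Topology.FourManifolds.LongAnnulusRelevel
import HarnessLib

/-!
# Long annuli with a level-true spanning arc: flat collars, the axis, level-wise operations

Topic `Literature/Topology/FourManifolds`; fourth infrastructure file of the straightening of a
spanning arc in the proof programme of the Fox–Milnor fact
`Literature.Topology.FourManifolds.Knot.exists_isConnectedSum_isConcordant`. Everything here is
proved; no named fact is introduced.

After `LongAnnulus.exists_relevel` the spanning arc `τ ↦ F (θ₁, τ)` is level-true. This file
provides the vocabulary and the general operations used to make it the vertical **axis**
`{x₀} × ℝ` with controlled first-order data:

* `LongAnnulus.FlatAt A θ₁ ζ x₀ e σ` — the two end curves are the *same straight arc*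
  `x₀ + σ θ • e` for `θ ∈ [θ₁ - ζ, θ₁ + ζ]` (`σ θ₁ = 0`, `σ' > 0`, `‖e‖ = 1`): the flat-arc data of
  the matched pair of end knots. Transported along equal end curves (`FlatAt.of_k_eq`); the
  collars are then the flat strips (`FlatAt.F_of_le/ge`) and the `θ`-derivative at `θ₁` in the
  collars is `(σ' θ₁ • e, 0)` (`FlatAt.fderiv_F_of_le/ge`, including the collar ends by
  continuity).
* `LongAnnulus.IsAxis A θ₁ x₀ : Prop` — `F (θ₁, s) = (x₀, s)` for all `s`; then
  `DF (0, 1) = (0, 1)` along the axis and, by immersivity, the spatial part of `DF (1, 0)` never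
  vanishes on `[1, 2]` (`IsAxis.fst_fderiv_ne_zero`), hence nowhere, given flat collars
  (`IsAxis.fst_fderiv_ne_zero'`).
* General level-wise operations `LongAnnulus η → LongAnnulus η` keeping the end curves and the
  levels: `translateWith` (position `+ d (level)`, `d = 0` at collar levels), `linearWith`
  (position `x₀ + M level (position - x₀)` for a smooth family of invertible linear maps, the
  identity at collar levels) and `relevelWith` (the fibrewise level move `Relevel.R c B` of
  `LongAnnulusRelevel.lean`, `B = 0` off the open middle); with their effect on the axis and on the
  `θ`-derivative along it (`fderiv_linearWith_F_axis`, `fderiv_relevelWith_F_axis`).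
* `injective_fderiv_of_leftInverse_apply` — a map with a differentiable left inverse has injective
  differential (used for all three operations).

## References

* M. W. Hirsch, *Differential Topology*, GTM 33 (1976), Ch. 4 §§5–6, Ch. 8 §1. [HirschDT1976]

## Design notes

No named facts, no `sorry`; `𝔼 n` is local notation as in `Knots.lean`.
-/

open scoped Topology ContDiff RealInnerProductSpace
open Function Set Metric Filter

noncomputable section

namespace Literature.Topology.FourManifolds

/-- Local notation: `𝔼 n` is the model Euclidean space `EuclideanSpace ℝ (Fin n)`. -/
local notation "𝔼 " n:arg => EuclideanSpace ℝ (Fin n)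

/-! ### Left inverses and injective differentials -/

/-- **A map with a differentiable left inverse has injective differential** (chain rule:
`DΨ ∘ DΦ = id`). [folklore] -/
theorem injective_fderiv_of_leftInverse_apply {E : Type*} [NormedAddCommGroup E] [NormedSpace ℝ E]
    {Φ Ψ : E → E} (hΦ : Differentiable ℝ Φ) (hΨ : Differentiable ℝ Ψ) (h : ∀ x, Ψ (Φ x) = x)
    (p : E) : Injective (fderiv ℝ Φ p) := by
  have hcomp : fderiv ℝ (Ψ ∘ Φ) p = (fderiv ℝ Ψ (Φ p)).comp (fderiv ℝ Φ p) := fderiv_comp p (hΨ _) (hΦ p)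
  have hid : Ψ ∘ Φ = id := funext h
  rw [hid, fderiv_id] at hcomp
  refine LeftInverse.injective (g := fderiv ℝ Ψ (Φ p)) fun w ↦ ?_
  have := congrArg (fun L : E →L[ℝ] E ↦ L w) hcomp
  simpa using this.symm

namespace LongAnnulus

variable {η : ℝ} (A : LongAnnulus η)

/-! ### Flat collars near an angle -/

/-- **Flat collars at `θ₁`**: both end curves of the long annulus are the straight arc
`x₀ + σ θ • e` for `θ ∈ [θ₁ - ζ, θ₁ + ζ]`, with `σ θ₁ = 0`, `σ' > 0` on the window and `‖e‖ = 1`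
(the common flat arc of a matched pair of end knots, `KnotFlatArc.lean`). [folklore] -/
structure FlatAt (θ₁ ζ : ℝ) (x₀ e : 𝔼 3) (σ : ℝ → ℝ) : Prop where
  ζ_pos : 0 < ζ
  norm_e : ‖e‖ = 1
  contDiff_σ : ContDiff ℝ ∞ σ
  σ_θ₁ : σ θ₁ = 0
  deriv_σ_pos : ∀ θ ∈ Icc (θ₁ - ζ) (θ₁ + ζ), 0 < deriv σ θ
  k₁_eq : ∀ θ ∈ Icc (θ₁ - ζ) (θ₁ + ζ), A.k₁ θ = x₀ + σ θ • e
  k₂_eq : ∀ θ ∈ Icc (θ₁ - ζ) (θ₁ + ζ), A.k₂ θ = x₀ + σ θ • e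

namespace FlatAt

variable {A} {θ₁ ζ : ℝ} {x₀ e : 𝔼 3} {σ : ℝ → ℝ} (h : A.FlatAt θ₁ ζ x₀ e σ)
include h

/-- Flatness is transported along equal end curves. [folklore] -/
theorem of_k_eq {η' : ℝ} {B : LongAnnulus η'} (h₁ : B.k₁ = A.k₁) (h₂ : B.k₂ = A.k₂) :
    B.FlatAt θ₁ ζ x₀ e σ where
  ζ_pos := h.ζ_pos
  norm_e := h.norm_e
  contDiff_σ := h.contDiff_σ
  σ_θ₁ := h.σ_θ₁
  deriv_σ_pos := h.deriv_σ_pos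
  k₁_eq θ hθ := by rw [h₁]; exact h.k₁_eq θ hθ
  k₂_eq θ hθ := by rw [h₂]; exact h.k₂_eq θ hθ

/-- `e ≠ 0`. [folklore] -/
theorem e_ne_zero : e ≠ 0 := by
  intro he; have := h.norm_e; rw [he, norm_zero] at this; exact zero_ne_one this

/-- `θ₁` is in the window. [folklore] -/
theorem θ₁_mem : θ₁ ∈ Icc (θ₁ - ζ) (θ₁ + ζ) := ⟨by linarith [h.ζ_pos], by linarith [h.ζ_pos]⟩

/-- The lower end curve passes through `x₀` at `θ₁`. [folklore] -/
theorem k₁_θ₁ : A.k₁ θ₁ = x₀ := by rw [h.k₁_eq θ₁ h.θ₁_mem, h.σ_θ₁, zero_smul, add_zero]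

/-- The upper end curve passes through `x₀` at `θ₁`. [folklore] -/
theorem k₂_θ₁ : A.k₂ θ₁ = x₀ := by rw [h.k₂_eq θ₁ h.θ₁_mem, h.σ_θ₁, zero_smul, add_zero]

/-- **The velocity vector of the flat arc at `θ₁`**, `w₀ = σ' θ₁ • e`; it is nonzero. [folklore] -/
theorem w₀_ne_zero : deriv σ θ₁ • e ≠ 0 :=
  smul_ne_zero (h.deriv_σ_pos θ₁ h.θ₁_mem).ne' h.e_ne_zero

/-- In the lower collar over the window the annulus is the flat strip. [folklore] -/
theorem F_of_le {θ s : ℝ} (hθ : θ ∈ Icc (θ₁ - ζ) (θ₁ + ζ)) (hs : s ≤ 1 + η) :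
    A.F (θ, s) = (x₀ + σ θ • e, s) := by
  rw [A.collar₁ θ s hs, h.k₁_eq θ hθ]

/-- In the upper collar over the window the annulus is the flat strip. [folklore] -/
theorem F_of_ge {θ s : ℝ} (hθ : θ ∈ Icc (θ₁ - ζ) (θ₁ + ζ)) (hs : 2 - η ≤ s) :
    A.F (θ, s) = (x₀ + σ θ • e, s) := by
  rw [A.collar₂ θ s hs, h.k₂_eq θ hθ]

/-- The derivative of the flat strip `(θ, s) ↦ (x₀ + σ θ • e, s)`. [folklore] -/
theorem hasFDerivAt_flatStrip (q : ℝ × ℝ) :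
    HasFDerivAt (fun q : ℝ × ℝ ↦ ((x₀ + σ q.1 • e, q.2) : 𝔼 3 × ℝ))
      ((((ContinuousLinearMap.fst ℝ ℝ ℝ).smulRight (deriv σ q.1)).smulRight e).prod
        (ContinuousLinearMap.snd ℝ ℝ ℝ)) q := by
  have hσ0 : HasFDerivAt (fun q : ℝ × ℝ ↦ σ q.1)
      (((1 : ℝ →L[ℝ] ℝ).smulRight (deriv σ q.1)).comp (ContinuousLinearMap.fst ℝ ℝ ℝ)) q :=
    ((h.contDiff_σ.differentiable (by simp)) q.1).hasDerivAt.hasFDerivAt.comp q hasFDerivAt_fst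
  have hσ : HasFDerivAt (fun q : ℝ × ℝ ↦ σ q.1)
      ((ContinuousLinearMap.fst ℝ ℝ ℝ).smulRight (deriv σ q.1)) q := by
    refine hσ0.congr_fderiv (ContinuousLinearMap.ext fun v ↦ ?_)
    simp
  exact ((hσ.smul_const e).const_add x₀).prodMk hasFDerivAt_snd

/-- **The `θ`-derivative at `θ₁` in the open lower collar** is `(σ' θ₁ • e, 0)`, the
`s`-derivative `(0, 1)`. [folklore] -/
theorem fderiv_F_of_lt {s : ℝ} (hs : s < 1 + η) :
    fderiv ℝ A.F (θ₁, s) = (((ContinuousLinearMap.fst ℝ ℝ ℝ).smulRight (deriv σ θ₁)).smulRight e).prod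
      (ContinuousLinearMap.snd ℝ ℝ ℝ) := by
  have hev : A.F =ᶠ[𝓝 (θ₁, s)] fun q : ℝ × ℝ ↦ ((x₀ + σ q.1 • e, q.2) : 𝔼 3 × ℝ) := by
    have hO : IsOpen (Ioo (θ₁ - ζ) (θ₁ + ζ) ×ˢ Iio (1 + η)) := isOpen_Ioo.prod isOpen_Iio
    filter_upwards [hO.mem_nhds ⟨⟨by linarith [h.ζ_pos], by linarith [h.ζ_pos]⟩, hs⟩] with q hq
    exact h.F_of_le (Ioo_subset_Icc_self hq.1) hq.2.le
  rw [hev.fderiv_eq, (h.hasFDerivAt_flatStrip (θ₁, s)).fderiv]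

/-- The same in the open upper collar. [folklore] -/
theorem fderiv_F_of_gt {s : ℝ} (hs : 2 - η < s) :
    fderiv ℝ A.F (θ₁, s) = (((ContinuousLinearMap.fst ℝ ℝ ℝ).smulRight (deriv σ θ₁)).smulRight e).prod
      (ContinuousLinearMap.snd ℝ ℝ ℝ) := by
  have hev : A.F =ᶠ[𝓝 (θ₁, s)] fun q : ℝ × ℝ ↦ ((x₀ + σ q.1 • e, q.2) : 𝔼 3 × ℝ) := by
    have hO : IsOpen (Ioo (θ₁ - ζ) (θ₁ + ζ) ×ˢ Ioi (2 - η)) := isOpen_Ioo.prod isOpen_Ioi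
    filter_upwards [hO.mem_nhds ⟨⟨by linarith [h.ζ_pos], by linarith [h.ζ_pos]⟩, hs⟩] with q hq
    exact h.F_of_ge (Ioo_subset_Icc_self hq.1) hq.2.le
  rw [hev.fderiv_eq, (h.hasFDerivAt_flatStrip (θ₁, s)).fderiv]

/-- **The `θ`-derivative at `θ₁` in the closed lower collar** (`s ≤ 1 + η`, by continuity of
`fderiv` at the collar end): `DF (θ₁, s) (1, 0) = (σ' θ₁ • e, 0)`. [folklore] -/
theorem fderiv_F_one_zero_of_le {s : ℝ} (hs : s ≤ 1 + η) :
    fderiv ℝ A.F (θ₁, s) ((1, 0) : ℝ × ℝ) = ((deriv σ θ₁ • e, 0) : 𝔼 3 × ℝ) := by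
  -- the set of `s` where the identity holds is closed and contains `(-∞, 1 + η)`
  have hcont : Continuous fun s : ℝ ↦ fderiv ℝ A.F (θ₁, s) ((1, 0) : ℝ × ℝ) :=
    ((A.contDiff_F.continuous_fderiv (by simp)).comp (continuous_const.prodMk continuous_id)).clm_apply
      continuous_const
  have hclosed : IsClosed {s : ℝ | fderiv ℝ A.F (θ₁, s) ((1, 0) : ℝ × ℝ) = ((deriv σ θ₁ • e, 0) : 𝔼 3 × ℝ)} :=
    isClosed_eq hcont continuous_const
  have hsub : Iio (1 + η) ⊆ {s : ℝ | fderiv ℝ A.F (θ₁, s) ((1, 0) : ℝ × ℝ) = ((deriv σ θ₁ • e, 0) : 𝔼 3 × ℝ)} := by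
    intro s hs
    show fderiv ℝ A.F (θ₁, s) ((1, 0) : ℝ × ℝ) = _
    rw [h.fderiv_F_of_lt hs]
    simp
  have := (closure_minimal hsub hclosed) (by rw [closure_Iio]; exact hs)
  exact this

/-- The same in the closed upper collar. [folklore] -/
theorem fderiv_F_one_zero_of_ge {s : ℝ} (hs : 2 - η ≤ s) :
    fderiv ℝ A.F (θ₁, s) ((1, 0) : ℝ × ℝ) = ((deriv σ θ₁ • e, 0) : 𝔼 3 × ℝ) := by
  have hcont : Continuous fun s : ℝ ↦ fderiv ℝ A.F (θ₁, s) ((1, 0) : ℝ × ℝ) :=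
    ((A.contDiff_F.continuous_fderiv (by simp)).comp (continuous_const.prodMk continuous_id)).clm_apply
      continuous_const
  have hclosed : IsClosed {s : ℝ | fderiv ℝ A.F (θ₁, s) ((1, 0) : ℝ × ℝ) = ((deriv σ θ₁ • e, 0) : 𝔼 3 × ℝ)} :=
    isClosed_eq hcont continuous_const
  have hsub : Ioi (2 - η) ⊆ {s : ℝ | fderiv ℝ A.F (θ₁, s) ((1, 0) : ℝ × ℝ) = ((deriv σ θ₁ • e, 0) : 𝔼 3 × ℝ)} := by
    intro s hs
    show fderiv ℝ A.F (θ₁, s) ((1, 0) : ℝ × ℝ) = _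
    rw [h.fderiv_F_of_gt hs]
    simp
  have := (closure_minimal hsub hclosed) (by rw [closure_Ioi]; exact hs)
  exact this

end FlatAt

/-! ### The axis -/

/-- **The spanning arc at `θ₁` is the vertical axis `{x₀} × ℝ`, level-true.** [folklore] -/
def IsAxis (θ₁ : ℝ) (x₀ : 𝔼 3) : Prop := ∀ s, A.F (θ₁, s) = (x₀, s)

namespace IsAxis

variable {A} {θ₁ : ℝ} {x₀ : 𝔼 3} (h : A.IsAxis θ₁ x₀)
include h

/-- Along the axis the `s`-derivative is `(0, 1)`. [folklore] -/
theorem fderiv_zero_one (s : ℝ) : fderiv ℝ A.F (θ₁, s) ((0, 1) : ℝ × ℝ) = ((0, 1) : 𝔼 3 × ℝ) := by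
  have h1 := A.hasDerivAt_arc θ₁ s
  have h2 : HasDerivAt (fun τ ↦ A.F (θ₁, τ)) ((0, 1) : 𝔼 3 × ℝ) s := by
    have : (fun τ ↦ A.F (θ₁, τ)) = fun τ ↦ ((x₀, τ) : 𝔼 3 × ℝ) := funext h
    rw [this]
    exact (hasDerivAt_const s x₀).prodMk (hasDerivAt_id s)
  exact h1.unique h2

/-- **Along the axis the spatial `θ`-derivative does not vanish over `[1, 2]`** (otherwise
`DF (1, -w₄) = 0`, contradicting immersivity). [folklore] -/
theorem fst_fderiv_ne_zero {s : ℝ} (hs : s ∈ Icc (1 : ℝ) 2) :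
    (fderiv ℝ A.F (θ₁, s) ((1, 0) : ℝ × ℝ)).1 ≠ 0 := by
  intro h0
  set w₄ := (fderiv ℝ A.F (θ₁, s) ((1, 0) : ℝ × ℝ)).2 with hw₄
  have hv : fderiv ℝ A.F (θ₁, s) ((1, -w₄) : ℝ × ℝ) = 0 := by
    have e1 : ((1, -w₄) : ℝ × ℝ) = ((1, 0) : ℝ × ℝ) - w₄ • ((0, 1) : ℝ × ℝ) := by ext <;> simp
    rw [e1, map_sub, map_smul, h.fderiv_zero_one]
    ext
    · simp [h0]
    · simp [hw₄]
  have := (injective_iff_map_eq_zero _).1 (A.injective_fderiv (θ₁, s) hs) _ hv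
  simp at this

/-- Position of the axis. [folklore] -/
theorem fst_F (s : ℝ) : (A.F (θ₁, s)).1 = x₀ := by rw [h s]

/-- Level of the axis. [folklore] -/
theorem snd_F (s : ℝ) : (A.F (θ₁, s)).2 = s := by rw [h s]

end IsAxis

/-- **With flat collars, the spatial `θ`-derivative along the axis vanishes nowhere.** [folklore] -/
theorem IsAxis.fst_fderiv_ne_zero' {θ₁ ζ : ℝ} {x₀ e : 𝔼 3} {σ : ℝ → ℝ} (h : A.IsAxis θ₁ x₀)
    (hf : A.FlatAt θ₁ ζ x₀ e σ) (s : ℝ) : (fderiv ℝ A.F (θ₁, s) ((1, 0) : ℝ × ℝ)).1 ≠ 0 := by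
  by_cases h1 : s ≤ 1 + η
  · rw [hf.fderiv_F_one_zero_of_le h1]; exact hf.w₀_ne_zero
  by_cases h2 : 2 - η ≤ s
  · rw [hf.fderiv_F_one_zero_of_ge h2]; exact hf.w₀_ne_zero
  push Not at h1 h2
  exact h.fst_fderiv_ne_zero ⟨by linarith [A.η_pos], by linarith [A.η_pos]⟩

/-! ### Level-wise translation -/

section Translate

variable (d : ℝ → 𝔼 3) (hd : ContDiff ℝ ∞ d) (hd₁ : ∀ t, t ≤ 1 + η → d t = 0)
  (hd₂ : ∀ t, 2 - η ≤ t → d t = 0)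

/-- **Level-wise translation** of a long annulus: position `+ d (level)`, for a `C^∞`
`d : ℝ → ℝ³` vanishing at collar levels. [folklore] -/
def translateWith : LongAnnulus η where
  F p := ((A.F p).1 + d (A.F p).2, (A.F p).2)
  k₁ := A.k₁
  k₂ := A.k₂
  contDiff_F := ((contDiff_fst.comp A.contDiff_F).add (hd.comp (contDiff_snd.comp A.contDiff_F))).prodMk
    (contDiff_snd.comp A.contDiff_F)
  η_pos := A.η_pos
  η_le := A.η_le
  F_add_one θ s := by simp only [A.F_add_one]
  collar₁ θ s hs := by simp only [A.collar₁ θ s hs, hd₁ s hs, add_zero]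
  collar₂ θ s hs := by simp only [A.collar₂ θ s hs, hd₂ s hs, add_zero]
  margin η' hη' θ s hs := A.margin η' hη' θ s hs
  margin_Ioo η' hη' θ s hs := A.margin_Ioo η' hη' θ s hs
  inj p q hp hq he := by
    simp only [Prod.mk.injEq] at he
    obtain ⟨h1, h2⟩ := he
    rw [h2] at h1
    exact A.inj p q hp hq (Prod.ext (add_right_cancel h1) h2)
  injective_fderiv p hp := by
    set Tr : 𝔼 3 × ℝ → 𝔼 3 × ℝ := fun q ↦ (q.1 + d q.2, q.2) with hTr
    set Tr' : 𝔼 3 × ℝ → 𝔼 3 × ℝ := fun q ↦ (q.1 - d q.2, q.2) with hTr'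
    have hTrs : ContDiff ℝ ∞ Tr := (contDiff_fst.add (hd.comp contDiff_snd)).prodMk contDiff_snd
    have hTr's : ContDiff ℝ ∞ Tr' := (contDiff_fst.sub (hd.comp contDiff_snd)).prodMk contDiff_snd
    have hinv : ∀ q, Tr' (Tr q) = q := fun q ↦ by simp [hTr, hTr']
    have hF : (fun p ↦ (((A.F p).1 + d (A.F p).2, (A.F p).2) : 𝔼 3 × ℝ)) = Tr ∘ A.F := rfl
    rw [hF, fderiv_comp p ((hTrs.differentiable (by simp)) _) ((A.contDiff_F.differentiable (by simp)) p)]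
    exact (injective_fderiv_of_leftInverse_apply (hTrs.differentiable (by simp)) (hTr's.differentiable (by simp))
      hinv _).comp (A.injective_fderiv p hp)

/-- The map of the translated annulus. [folklore] -/
@[simp] theorem translateWith_F (p : ℝ × ℝ) :
    (A.translateWith d hd hd₁ hd₂).F p = ((A.F p).1 + d (A.F p).2, (A.F p).2) := rfl

/-- Same lower end curve. [folklore] -/
@[simp] theorem translateWith_k₁ : (A.translateWith d hd hd₁ hd₂).k₁ = A.k₁ := rfl

/-- Same upper end curve. [folklore] -/
@[simp] theorem translateWith_k₂ : (A.translateWith d hd hd₁ hd₂).k₂ = A.k₂ := rfl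

end Translate

/-! ### Level-wise linear maps about an axis -/

section Linear

variable (x₀ : 𝔼 3) (M Minv : ℝ → 𝔼 3 →L[ℝ] 𝔼 3)
  (hM : ContDiff ℝ ∞ fun q : 𝔼 3 × ℝ ↦ M q.2 q.1)
  (hMinv : ContDiff ℝ ∞ fun q : 𝔼 3 × ℝ ↦ Minv q.2 q.1)
  (hinv : ∀ t x, Minv t (M t x) = x)
  (hid₁ : ∀ t, t ≤ 1 + η → M t = ContinuousLinearMap.id ℝ (𝔼 3))
  (hid₂ : ∀ t, 2 - η ≤ t → M t = ContinuousLinearMap.id ℝ (𝔼 3))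

/-- The level-wise linear map about the axis `{x₀} × ℝ`: `(x, t) ↦ (x₀ + M t (x - x₀), t)`.
[folklore] -/
def linMap (q : 𝔼 3 × ℝ) : 𝔼 3 × ℝ := (x₀ + M q.2 (q.1 - x₀), q.2)

/-- The level-wise linear map is `C^∞`. [folklore] -/
theorem contDiff_linMap (hM : ContDiff ℝ ∞ fun q : 𝔼 3 × ℝ ↦ M q.2 q.1) :
    ContDiff ℝ ∞ (linMap x₀ M) := by
  have : (fun q : 𝔼 3 × ℝ ↦ M q.2 (q.1 - x₀)) = (fun q : 𝔼 3 × ℝ ↦ M q.2 q.1) ∘ fun q ↦ (q.1 - x₀, q.2) := rfl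
  refine (contDiff_const.add ?_).prodMk contDiff_snd
  rw [this]
  exact hM.comp ((contDiff_fst.sub contDiff_const).prodMk contDiff_snd)

include hinv in
/-- The level-wise linear map by `Minv` undoes the one by `M`. [folklore] -/
theorem linMap_linMap (q : 𝔼 3 × ℝ) : linMap x₀ Minv (linMap x₀ M q) = q := by
  obtain ⟨x, t⟩ := q
  simp [linMap, hinv]

/-- **Level-wise linear operation** on a long annulus about the axis `{x₀} × ℝ`: position
`x₀ + M level (position - x₀)`, for a smooth family `M` of linear maps with smooth left inverses
`Minv`, equal to the identity at collar levels. [folklore] -/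
def linearWith : LongAnnulus η where
  F := linMap x₀ M ∘ A.F
  k₁ := A.k₁
  k₂ := A.k₂
  contDiff_F := (contDiff_linMap x₀ M hM).comp A.contDiff_F
  η_pos := A.η_pos
  η_le := A.η_le
  F_add_one θ s := by simp only [comp_apply, A.F_add_one]
  collar₁ θ s hs := by simp [linMap, A.collar₁ θ s hs, hid₁ s hs]
  collar₂ θ s hs := by simp [linMap, A.collar₂ θ s hs, hid₂ s hs]
  margin η' hη' θ s hs := A.margin η' hη' θ s hs
  margin_Ioo η' hη' θ s hs := A.margin_Ioo η' hη' θ s hs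
  inj p q hp hq he := by
    have := congrArg (linMap x₀ Minv) he
    simp only [comp_apply, linMap_linMap x₀ M Minv hinv] at this
    exact A.inj p q hp hq this
  injective_fderiv p hp := by
    have hLs := contDiff_linMap x₀ M hM
    have hL's := contDiff_linMap x₀ Minv hMinv
    rw [fderiv_comp p ((hLs.differentiable (by simp)) _) ((A.contDiff_F.differentiable (by simp)) p)]
    exact (injective_fderiv_of_leftInverse_apply (hLs.differentiable (by simp)) (hL's.differentiable (by simp))
      (linMap_linMap x₀ M Minv hinv) _).comp (A.injective_fderiv p hp)

/-- The map of the new annulus. [folklore] -/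
@[simp] theorem linearWith_F (p : ℝ × ℝ) :
    (A.linearWith x₀ M Minv hM hMinv hinv hid₁ hid₂).F p = (x₀ + M (A.F p).2 ((A.F p).1 - x₀), (A.F p).2) := rfl

/-- Same lower end curve. [folklore] -/
@[simp] theorem linearWith_k₁ : (A.linearWith x₀ M Minv hM hMinv hinv hid₁ hid₂).k₁ = A.k₁ := rfl

/-- Same upper end curve. [folklore] -/
@[simp] theorem linearWith_k₂ : (A.linearWith x₀ M Minv hM hMinv hinv hid₁ hid₂).k₂ = A.k₂ := rfl

/-- **The differential of the level-wise linear map on the axis**: at `(x₀, t)` it is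
`(ξ, τ) ↦ (M t ξ, τ)` (directional derivatives along the two coordinate directions). [folklore] -/
theorem fderiv_linMap_axis (hM : ContDiff ℝ ∞ fun q : 𝔼 3 × ℝ ↦ M q.2 q.1) (t : ℝ) (v : 𝔼 3 × ℝ) :
    fderiv ℝ (linMap x₀ M) (x₀, t) v = (M t v.1, v.2) := by
  have hd : DifferentiableAt ℝ (linMap x₀ M) (x₀, t) :=
    ((contDiff_linMap x₀ M hM).differentiable (by simp)) _
  -- horizontal direction
  have hhor : ∀ ξ : 𝔼 3, fderiv ℝ (linMap x₀ M) (x₀, t) ((ξ, 0) : 𝔼 3 × ℝ) = ((M t ξ, 0) : 𝔼 3 × ℝ) := by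
    intro ξ
    have hcurve : HasDerivAt (fun r : ℝ ↦ ((x₀ + r • ξ, t) : 𝔼 3 × ℝ)) ((ξ, 0) : 𝔼 3 × ℝ) 0 := by
      have h1 : HasDerivAt (fun r : ℝ ↦ x₀ + r • ξ) ξ 0 := by
        simpa using ((hasDerivAt_id (0 : ℝ)).smul_const ξ).const_add x₀
      exact h1.prodMk (hasDerivAt_const _ _)
    have hcomp : HasDerivAt (fun r : ℝ ↦ linMap x₀ M (x₀ + r • ξ, t))
        (fderiv ℝ (linMap x₀ M) (x₀, t) ((ξ, 0) : 𝔼 3 × ℝ)) 0 :=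
      hd.hasFDerivAt.comp_hasDerivAt_of_eq (0 : ℝ) hcurve (by simp)
    have hdirect : HasDerivAt (fun r : ℝ ↦ linMap x₀ M (x₀ + r • ξ, t)) ((M t ξ, 0) : 𝔼 3 × ℝ) 0 := by
      have e : (fun r : ℝ ↦ linMap x₀ M (x₀ + r • ξ, t)) = fun r ↦ ((x₀ + r • M t ξ, t) : 𝔼 3 × ℝ) := by
        funext r; simp [linMap]
      rw [e]
      have h1 : HasDerivAt (fun r : ℝ ↦ x₀ + r • M t ξ) (M t ξ) 0 := by
        simpa using ((hasDerivAt_id (0 : ℝ)).smul_const (M t ξ)).const_add x₀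
      exact h1.prodMk (hasDerivAt_const _ _)
    exact hcomp.unique hdirect
  -- vertical direction
  have hver : ∀ τ : ℝ, fderiv ℝ (linMap x₀ M) (x₀, t) ((0, τ) : 𝔼 3 × ℝ) = ((0, τ) : 𝔼 3 × ℝ) := by
    intro τ
    have hcurve : HasDerivAt (fun r : ℝ ↦ ((x₀, t + r • τ) : 𝔼 3 × ℝ)) ((0, τ) : 𝔼 3 × ℝ) 0 :=
      (hasDerivAt_const _ _).prodMk (by simpa using ((hasDerivAt_id (0 : ℝ)).smul_const τ).const_add t)
    have hcomp : HasDerivAt (fun r : ℝ ↦ linMap x₀ M (x₀, t + r • τ))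
        (fderiv ℝ (linMap x₀ M) (x₀, t) ((0, τ) : 𝔼 3 × ℝ)) 0 :=
      hd.hasFDerivAt.comp_hasDerivAt_of_eq (0 : ℝ) hcurve (by simp)
    have hdirect : HasDerivAt (fun r : ℝ ↦ linMap x₀ M (x₀, t + r • τ)) ((0, τ) : 𝔼 3 × ℝ) 0 := by
      have e : (fun r : ℝ ↦ linMap x₀ M (x₀, t + r • τ)) = fun r ↦ ((x₀, t + r • τ) : 𝔼 3 × ℝ) := by
        funext r; simp [linMap]
      rw [e]; exact hcurve
    exact hcomp.unique hdirect
  have hsplit : v = ((v.1, 0) : 𝔼 3 × ℝ) + ((0, v.2) : 𝔼 3 × ℝ) := by ext <;> simp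
  conv_lhs => rw [hsplit]
  rw [map_add, hhor, hver]
  ext <;> simp

/-- **The `θ`-derivative of the new annulus along the axis**: if `F (θ₁, s) = (x₀, s)` then
`D(linearWith).F (θ₁, s) (1, 0) = (M s w, w₄)` where `(w, w₄) = DF (θ₁, s) (1, 0)`. [folklore] -/
theorem fderiv_linearWith_F_axis {θ₁ : ℝ} (hax : A.IsAxis θ₁ x₀) (s : ℝ) :
    fderiv ℝ (A.linearWith x₀ M Minv hM hMinv hinv hid₁ hid₂).F (θ₁, s) ((1, 0) : ℝ × ℝ) =
      (M s (fderiv ℝ A.F (θ₁, s) ((1, 0) : ℝ × ℝ)).1, (fderiv ℝ A.F (θ₁, s) ((1, 0) : ℝ × ℝ)).2) := by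
  show fderiv ℝ (linMap x₀ M ∘ A.F) (θ₁, s) ((1, 0) : ℝ × ℝ) = _
  rw [fderiv_comp (θ₁, s) (((contDiff_linMap x₀ M hM).differentiable (by simp)) _)
    ((A.contDiff_F.differentiable (by simp)) _), ContinuousLinearMap.coe_comp, comp_apply, hax s,
    fderiv_linMap_axis x₀ M hM]

/-- The level-wise linear operation preserves the axis. [folklore] -/
theorem isAxis_linearWith {θ₁ : ℝ} (hax : A.IsAxis θ₁ x₀) :
    (A.linearWith x₀ M Minv hM hMinv hinv hid₁ hid₂).IsAxis θ₁ x₀ := fun s ↦ by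
  simp [hax s]

end Linear

/-! ### The fibrewise level move as an operation -/

section RelevelWith

open Relevel

variable (c : 𝔼 3 → ℝ) (B : ℝ → ℝ) {K : ℝ} (hc : ContDiff ℝ ∞ c) (hB : ContDiff ℝ ∞ B)
  (hK : ∀ t, |deriv B t| ≤ K) (hcK : ∀ x, |c x| * K < 1)
  (hBz : ∀ t ∉ Ioo (1 + η) (2 - η), B t = 0)

/-- **The fibrewise level move as an operation on long annuli**: `Relevel.R c B ∘ F`, for `B`
vanishing off the open middle `(1 + η, 2 - η)` and `|c| · sup |B'| < 1`. [folklore] -/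
def relevelWith : LongAnnulus η where
  F := R c B ∘ A.F
  k₁ := A.k₁
  k₂ := A.k₂
  contDiff_F := (contDiff_R hc hB).comp A.contDiff_F
  η_pos := A.η_pos
  η_le := A.η_le
  F_add_one θ s := by simp only [comp_apply, A.F_add_one]
  collar₁ θ s hs := by
    simp only [comp_apply, A.collar₁ θ s hs]
    exact R_of_B_eq_zero (hBz s (fun h ↦ by linarith [h.1]))
  collar₂ θ s hs := by
    simp only [comp_apply, A.collar₂ θ s hs]
    exact R_of_B_eq_zero (hBz s (fun h ↦ by linarith [h.2]))
  margin η' hη' θ s hs := by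
    simp only [comp_apply, R_snd]
    have hm := A.margin η' hη' θ s hs
    by_cases hmid : (A.F (θ, s)).2 ∈ Ioo (1 + η) (2 - η)
    · have := lmap_mem_Ioo hB hK hcK hBz (A.F (θ, s)).1 hmid
      exact ⟨by linarith [this.1, hη'.2], by linarith [this.2, hη'.2]⟩
    · rw [lmap_of_not_mem hBz _ hmid]; exact hm
  margin_Ioo η' hη' θ s hs := by
    simp only [comp_apply, R_snd]
    have hm := A.margin_Ioo η' hη' θ s hs
    by_cases hmid : (A.F (θ, s)).2 ∈ Ioo (1 + η) (2 - η)
    · have := lmap_mem_Ioo hB hK hcK hBz (A.F (θ, s)).1 hmid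
      exact ⟨by linarith [this.1, hη'.2], by linarith [this.2, hη'.2]⟩
    · rw [lmap_of_not_mem hBz _ hmid]; exact hm
  inj p q hp hq he := A.inj p q hp hq (R_injective hB hK hcK he)
  injective_fderiv p hp := by
    rw [fderiv_comp p (((contDiff_R hc hB).differentiable (by simp)) _)
      ((A.contDiff_F.differentiable (by simp)) p)]
    exact (injective_fderiv_R hB hK hcK hc _).comp (A.injective_fderiv p hp)

/-- The map of the new annulus. [folklore] -/
@[simp] theorem relevelWith_F : (A.relevelWith c B hc hB hK hcK hBz).F = R c B ∘ A.F := rfl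

/-- Same lower end curve. [folklore] -/
@[simp] theorem relevelWith_k₁ : (A.relevelWith c B hc hB hK hcK hBz).k₁ = A.k₁ := rfl

/-- Same upper end curve. [folklore] -/
@[simp] theorem relevelWith_k₂ : (A.relevelWith c B hc hB hK hcK hBz).k₂ = A.k₂ := rfl

/-- **The differential of the level move**:
`DR (x, t) (ξ, τ) = (ξ, τ + c x B' t τ + B t Dc x ξ)`. [folklore] -/
theorem hasFDerivAt_R (hc : ContDiff ℝ ∞ c) (hB : ContDiff ℝ ∞ B) (q : 𝔼 3 × ℝ) :
    HasFDerivAt (R c B) ((ContinuousLinearMap.fst ℝ (𝔼 3) ℝ).prod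
      (ContinuousLinearMap.snd ℝ (𝔼 3) ℝ +
        (c q.1 • (((1 : ℝ →L[ℝ] ℝ).smulRight (deriv B q.2)).comp (ContinuousLinearMap.snd ℝ (𝔼 3) ℝ)) +
          B q.2 • ((fderiv ℝ c q.1).comp (ContinuousLinearMap.fst ℝ (𝔼 3) ℝ))))) q := by
  have hc' : HasFDerivAt (fun q : 𝔼 3 × ℝ ↦ c q.1) ((fderiv ℝ c q.1).comp (ContinuousLinearMap.fst ℝ (𝔼 3) ℝ)) q :=
    ((hc.differentiable (by simp)) q.1).hasFDerivAt.comp q hasFDerivAt_fst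
  have hB' : HasFDerivAt (fun q : 𝔼 3 × ℝ ↦ B q.2)
      (((1 : ℝ →L[ℝ] ℝ).smulRight (deriv B q.2)).comp (ContinuousLinearMap.snd ℝ (𝔼 3) ℝ)) q :=
    ((hB.differentiable (by simp)) q.2).hasDerivAt.hasFDerivAt.comp q hasFDerivAt_snd
  have hmul := hc'.mul hB'
  exact hasFDerivAt_fst.prodMk (hasFDerivAt_snd.add hmul)

/-- **The `θ`-derivative along the axis after the level move**: if `F (θ₁, s) = (x₀, s)` and
`c x₀ = 0`, then `D(relevelWith).F (θ₁, s) (1, 0) = (w, w₄ + B s · Dc x₀ w)`,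
`(w, w₄) = DF (θ₁, s) (1, 0)`. [folklore] -/
theorem fderiv_relevelWith_F_axis {θ₁ : ℝ} {x₀ : 𝔼 3} (hax : A.IsAxis θ₁ x₀) (hc0 : c x₀ = 0) (s : ℝ) :
    fderiv ℝ (A.relevelWith c B hc hB hK hcK hBz).F (θ₁, s) ((1, 0) : ℝ × ℝ) =
      ((fderiv ℝ A.F (θ₁, s) ((1, 0) : ℝ × ℝ)).1,
        (fderiv ℝ A.F (θ₁, s) ((1, 0) : ℝ × ℝ)).2 +
          B s * fderiv ℝ c x₀ (fderiv ℝ A.F (θ₁, s) ((1, 0) : ℝ × ℝ)).1) := by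
  show fderiv ℝ (R c B ∘ A.F) (θ₁, s) ((1, 0) : ℝ × ℝ) = _
  rw [fderiv_comp (θ₁, s) (((contDiff_R hc hB).differentiable (by simp)) _)
    ((A.contDiff_F.differentiable (by simp)) _), ContinuousLinearMap.coe_comp, comp_apply, hax s,
    (hasFDerivAt_R c B hc hB (x₀, s)).fderiv]
  simp [hc0]

/-- The level move preserves the axis when `c x₀ = 0`. [folklore] -/
theorem isAxis_relevelWith {θ₁ : ℝ} {x₀ : 𝔼 3} (hax : A.IsAxis θ₁ x₀) (hc0 : c x₀ = 0) :
    (A.relevelWith c B hc hB hK hcK hBz).IsAxis θ₁ x₀ := fun s ↦ by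
  simp [hax s, R_mk, lmap, hc0]

end RelevelWith

/-! ### Making a level-true arc the axis -/

/-- **Translation to the axis.** If the spanning arc at `θ₁` is level-true,
`(F (θ₁, s)).2 = s` for all `s`, and the collars are flat at `θ₁` through `x₀`, then the
level-wise translation by `d t = x₀ - (F (θ₁, t)).1` is a long annulus of the same width with the
same (flat) end curves and axis `{x₀} × ℝ`. [folklore] -/
theorem exists_isAxis_of_level_true {θ₁ ζ : ℝ} {x₀ e : 𝔼 3} {σ : ℝ → ℝ} (hf : A.FlatAt θ₁ ζ x₀ e σ)
    (hlev : ∀ s, (A.F (θ₁, s)).2 = s) :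
    ∃ B : LongAnnulus η, B.k₁ = A.k₁ ∧ B.k₂ = A.k₂ ∧ B.IsAxis θ₁ x₀ ∧
      (∀ p, (B.F p).2 = (A.F p).2) ∧ ∀ p, (B.F p).1 = (A.F p).1 + (x₀ - (A.F (θ₁, (A.F p).2)).1) := by
  set d : ℝ → 𝔼 3 := fun t ↦ x₀ - (A.F (θ₁, t)).1 with hd
  have hds : ContDiff ℝ ∞ d := contDiff_const.sub (A.contDiff_pos θ₁)
  have hd₁ : ∀ t, t ≤ 1 + η → d t = 0 := fun t ht ↦ by
    simp only [hd, A.collar₁ θ₁ t ht, hf.k₁_θ₁, sub_self]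
  have hd₂ : ∀ t, 2 - η ≤ t → d t = 0 := fun t ht ↦ by
    simp only [hd, A.collar₂ θ₁ t ht, hf.k₂_θ₁, sub_self]
  refine ⟨A.translateWith d hds hd₁ hd₂, rfl, rfl, fun s ↦ ?_, fun p ↦ rfl, fun p ↦ rfl⟩
  simp only [translateWith_F, hlev s, hd]
  ext1
  · simp
  · rfl

end LongAnnulus

end Literature.Topology.FourManifolds
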